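import Mathlib
import Summits.Ventures.HodgeRepro2.T5SchurTensorEquivariance
import Summits.Ventures.HodgeRepro2.T5HoweUniqueness
import Summits.Ventures.HodgeRepro2.T5IsotypicHom

/-!
# Howe uniqueness at the smooth level, module form: the partner is a quotient of `Θ(N)`

Blind cell `pub-hodge-repro2`, seat p8 (gen 6), Tier-5 kernel support for the N3 record
(§N3.12.4 (s1)–(s4) and its p-adic twin §N3.10.3; CHECK-N3 §7 / §9).  The chain of the record,
in kernel pieces: a non-zero `(G₁ × G₂)`-map `Φ : S → π₁ ⊠ π′` factors through `S[π₁]`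
(p391188 `T5TensorSeparation.exists_factor`); `S[π₁] ≅ π₁ ⊗ Θ(π₁)` with `Θ(π₁) = Hom_{G₁}(π₁, S[π₁])`
and `G₂` acting by post-composition (p392230 `evEquiv`, semisimplicity of `S[π₁]` from p393489 /
p393644); a `G₁ × G₂`-map `π₁ ⊗ Θ → π₁ ⊗ π′` is `1 ⊗ t` with `t` `G₂`-equivariant (p391579 /
p392068); `t ≠ 0` onto the irreducible `π′`; and `Θ(π₁)` has a unique irreducible quotient
(Howe 1989 Thm 2.1 / MVW chap. 2 III.4 — PRINTED), so `π′ ≅ θ(π₁)` (p391018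
`simple_quotients_equiv`).  This file composes the module-theoretic links into one statement, with
the second group modelled by a ring `R₂` (`H(G₂)⁺` or `k[G₂]`) acting on `V = S[π₁]` commuting
with `R` (`H(G₁)⁺`) and on `π′`:

* `smul_postcomp_eq` — post-composition with `r • ·` is the `R₂`-action on `Hom_R(N, V)`;
* `exists_surjective_of_equivariant` — **the partner is a quotient of `Θ(N)`**: for `V`
  semisimple `N`-isotypic (`N` simple with Schur), `π′` a simple `R₂`-module and a non-zero
  `R`-linear, `R₂`-equivariant `Φ : V → N ⊗[k] π′`, there is a SURJECTIVE `R₂`-linear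
  `t : Hom_R(N, V) → π′` with `Φ (f n) = n ⊗ t f`;
* `nonempty_linearEquiv_of_unique_coatom` — **uniqueness of the partner**: if moreover
  `Hom_R(N, V)` has a unique maximal `R₂`-submodule (the printed «unique irreducible quotient»),
  any two such partners are isomorphic.

What stays prose: the dictionary smooth representations ↔ non-degenerate Hecke modules, the
descent of the `G₂`-action to `S[π₁]` (bookkeeping), and the printed theorems supplying the unique
quotient and the Howe duality statements themselves.  Nothing arithmetic is asserted.

README §8(d): uses an L-value-free non-vanishing device: NO.
-/

namespace Summit.Ventures.HodgeRepro2.T5HoweSmooth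

open Summit.Ventures.HodgeRepro2

section Setup

variable {k R R₂ : Type*} [Field k] [Ring R] [Algebra k R] [Ring R₂] [Algebra k R₂]
  {N : Type*} [AddCommGroup N] [Module R N] [Module k N] [IsScalarTower k R N]
  {V : Type*} [AddCommGroup V] [Module R V] [Module k V] [IsScalarTower k R V]
  [Module R₂ V] [SMulCommClass R R₂ V] [SMulCommClass R₂ R V]

omit [Module k N] [IsScalarTower k R N] in
/-- Post-composition with the `R`-linear operator `r • ·` of `V` is the `R₂`-action on
`Hom_R(N, V)` (as a `k`-linear map of `Hom_R(N, V)`). -/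
theorem smul_postcomp_eq [IsScalarTower k R₂ V] (r : R₂) :
    T5IsotypicHom.postcomp k R N V (DistribSMul.toLinearMap R V r) =
      DistribSMul.toLinearMap k (N →ₗ[R] V) r := by
  apply LinearMap.ext
  intro f
  apply LinearMap.ext
  intro n
  rw [T5IsotypicHom.postcomp_apply]
  rfl

end Setup

section Partner

variable {k R R₂ : Type*} [Field k] [Ring R] [Algebra k R] [Ring R₂] [Algebra k R₂]
  {N : Type*} [AddCommGroup N] [Module R N] [Module k N] [IsScalarTower k R N]
  {V : Type*} [AddCommGroup V] [Module R V] [Module k V] [IsScalarTower k R V]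
  [Module R₂ V] [SMulCommClass R R₂ V] [SMulCommClass R₂ R V] [IsScalarTower k R₂ V]
  {P : Type*} [AddCommGroup P] [Module R₂ P] [Module k P] [IsScalarTower k R₂ P]

/-- **The partner is a quotient of `Θ(N) = Hom_R(N, V)`.** Let `N` be a simple `R`-module with
`End_R(N) = k`, `V` a semisimple `N`-isotypic `R`-module with a commuting `R₂`-action, `P` a simple
`R₂`-module, and `Φ : V → N ⊗[k] P` a non-zero `R`-linear map intertwining `r • ·` on `V` with
`1 ⊗ (r • ·)` on `N ⊗ P`.  Then there is a surjective `R₂`-linear `t : Hom_R(N, V) → P` with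
`Φ (f n) = n ⊗ t f` for all `n`, `f`. -/
theorem exists_surjective_of_equivariant [IsSimpleModule R N]
    (hSchur : ∀ φ : N →ₗ[R] N, ∃ c : k, ∀ x, φ x = c • x)
    [IsSemisimpleModule R V] (hV : IsIsotypicOfType R V N) [IsSimpleModule R₂ P]
    (Φ : V →ₗ[R] TensorProduct k N P) (hΦ : Φ ≠ 0)
    (hequiv : ∀ (r : R₂) (x : V),
      Φ (r • x) = TensorProduct.map LinearMap.id (DistribSMul.toLinearMap k P r) (Φ x)) :
    ∃ t : (N →ₗ[R] V) →ₗ[R₂] P, Function.Surjective t ∧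
      ∀ (n : N) (f : N →ₗ[R] V), Φ (f n) = n ⊗ₜ[k] t f := by
  haveI : Nontrivial N := IsSimpleModule.nontrivial R N
  -- `Ψ = Φ ∘ evEquiv : N ⊗ Hom_R(N, V) → N ⊗ P`
  set E := T5IsotypicHom.evEquiv hSchur hV with hE
  let Ψ : TensorProduct k N (N →ₗ[R] V) →ₗ[R] TensorProduct k N P := Φ ∘ₗ (E : _ →ₗ[R] V)
  -- `Ψ` intertwines `1 ⊗ (r • ·)` on both sides
  have hΨ : ∀ (r : R₂) (x : TensorProduct k N (N →ₗ[R] V)),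
      Ψ (TensorProduct.map LinearMap.id (DistribSMul.toLinearMap k (N →ₗ[R] V) r) x) =
        TensorProduct.map LinearMap.id (DistribSMul.toLinearMap k P r) (Ψ x) := by
    intro r x
    have h1 := T5IsotypicHom.evEquiv_postcomp hSchur hV
      (fun r : R₂ => DistribSMul.toLinearMap R V r) r x
    rw [smul_postcomp_eq] at h1
    change Φ (E (TensorProduct.map LinearMap.id (DistribSMul.toLinearMap k (N →ₗ[R] V) r) x)) =
      TensorProduct.map LinearMap.id (DistribSMul.toLinearMap k P r) (Φ (E x))
    rw [h1]
    exact hequiv r (E x)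
  obtain ⟨t₀, ht₀, hcomm⟩ := T5SchurTensorEquivariance.exists_linear_equivariant hSchur Ψ
    (fun r : R₂ => DistribSMul.toLinearMap k (N →ₗ[R] V) r)
    (fun r : R₂ => DistribSMul.toLinearMap k P r) hΨ
  -- upgrade `t₀` to an `R₂`-linear map
  let t : (N →ₗ[R] V) →ₗ[R₂] P :=
    { toFun := t₀
      map_add' := map_add t₀
      map_smul' := fun r f => hcomm r f }
  have ht : ∀ (n : N) (f : N →ₗ[R] V), Φ (f n) = n ⊗ₜ[k] t f := by
    intro n f
    have h := ht₀ n f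
    change Φ (E (n ⊗ₜ[k] f)) = n ⊗ₜ[k] t₀ f at h
    rw [T5IsotypicHom.evEquiv_tmul] at h
    exact h
  refine ⟨t, ?_, ht⟩
  apply LinearMap.surjective_of_ne_zero
  intro ht0
  apply hΦ
  apply LinearMap.ext
  intro v
  obtain ⟨x, rfl⟩ := E.surjective v
  change Ψ x = 0
  induction x using TensorProduct.induction_on with
  | zero => simp
  | tmul n f =>
    have := ht n f
    change Φ (E (n ⊗ₜ[k] f)) = 0
    rw [T5IsotypicHom.evEquiv_tmul, this]
    have h0 : t f = 0 := by rw [ht0]; rfl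
    rw [h0, TensorProduct.tmul_zero]
  | add x y hx hy => rw [map_add, hx, hy, add_zero]

/-- **Uniqueness of the partner.** If moreover `Hom_R(N, V)` has a unique maximal `R₂`-submodule
(the printed «unique irreducible quotient» of Howe / MVW), then any two simple `R₂`-modules `P₁`,
`P₂` admitting non-zero equivariant maps `V → N ⊗ Pᵢ` are isomorphic
(`T5HoweUniqueness.simple_quotients_equiv`). -/
theorem nonempty_linearEquiv_of_unique_coatom [IsSimpleModule R N]
    (hSchur : ∀ φ : N →ₗ[R] N, ∃ c : k, ∀ x, φ x = c • x)
    [IsSemisimpleModule R V] (hV : IsIsotypicOfType R V N)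
    (hΘ : ∃! J : Submodule R₂ (N →ₗ[R] V), IsCoatom J)
    {P₂ : Type*} [AddCommGroup P₂] [Module R₂ P₂] [Module k P₂] [IsScalarTower k R₂ P₂]
    [IsSimpleModule R₂ P] [IsSimpleModule R₂ P₂]
    (Φ₁ : V →ₗ[R] TensorProduct k N P) (hΦ₁ : Φ₁ ≠ 0)
    (hequiv₁ : ∀ (r : R₂) (x : V),
      Φ₁ (r • x) = TensorProduct.map LinearMap.id (DistribSMul.toLinearMap k P r) (Φ₁ x))
    (Φ₂ : V →ₗ[R] TensorProduct k N P₂) (hΦ₂ : Φ₂ ≠ 0)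
    (hequiv₂ : ∀ (r : R₂) (x : V),
      Φ₂ (r • x) = TensorProduct.map LinearMap.id (DistribSMul.toLinearMap k P₂ r) (Φ₂ x)) :
    Nonempty (P ≃ₗ[R₂] P₂) := by
  obtain ⟨t₁, ht₁, -⟩ := exists_surjective_of_equivariant hSchur hV Φ₁ hΦ₁ hequiv₁
  obtain ⟨t₂, ht₂, -⟩ := exists_surjective_of_equivariant hSchur hV Φ₂ hΦ₂ hequiv₂
  exact T5HoweUniqueness.simple_quotients_equiv hΘ t₁ t₂ ht₁ ht₂

end Partner

end Summit.Ventures.HodgeRepro2.T5HoweSmooth
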